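import Mathlib
import HarnessLib
import Summits.Ventures.LatticeQCDFlow.Scoring.SU3WeylDensityTracePolynomial

/-!
# The Jacobian of the `SU(3)` torus-to-trace map: `4 J(θ₁,θ₂)² = |Δ|² = weylSU3 θ₁ θ₂`, where `J = ∂(Re t, Im t)/∂(θ₁, θ₂)`

HONEST FRAMING: exact (Metropolis-corrected) sampling algorithms for lattice gauge theory;
figures of merit are autocorrelation/cost numbers at stated couplings and volumes; no
continuum-physics claim.

Venture `LatticeQCDFlow` (cell pub-lqcd), sub-topic `Scoring`; FANOUT row 21 (`su3-base`: the 4D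
`SU(3)` baselines).  NEW WORK of the cell (placement rule), elementary, over row 21 GEN-8's
`Scoring/SU3WeylDensityTracePolynomial` (`weylSU3_eq_prod_normSq`) and `Scoring/SU3TraceDeltoid`
(`su3Discriminant_eq_neg_prod_normSq`, `conj_eq_mul_of_unimodular`), and row 5's
`Scoring/OnePlaquetteSU3` (`weylSU3`, `reTrSU3`).  No definition is introduced; nothing is cited as
a fact; no number of ours.

The trace map of the maximal torus, `(θ₁, θ₂) ↦ t = e^{iθ₁} + e^{iθ₂} + e^{−i(θ₁+θ₂)} = R + iI`, has
partial derivatives `∂t/∂θ₁ = i(a − c)`, `∂t/∂θ₂ = i(b − c)` (`a, b, c` the three eigenvalues), so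
its real Jacobian determinant is `J = R₁ I₂ − R₂ I₁ = Im( conj(a − c)(b − c) )`.  With
`w = conj(a − c)(b − c)` one has `w − w̄ = (b − a)(c − a)(b − c)` (using `ā = bc` etc.), hence
`4 J² = −(w − w̄)² = −(a−b)²(a−c)²(b−c)² = |a−b|²|a−c|²|b−c|² = |Δ|²`:

  `4 J(θ₁, θ₂)² = weylSU3 θ₁ θ₂ = 27 − 18|t|² + 8 Re t³ − |t|⁴`.

So the trace map is a local diffeomorphism exactly off the walls of the Weyl alcove (degenerate
spectrum ⇔ deltoid boundary), and — NAMED ONLY, not proved here — the push-forward of Haar measure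
to the trace variable has density proportional to `|Δ|²/|J| = 2|J| = √(27 − 18|t|² + 8 Re t³ − |t|⁴)`
with respect to planar Lebesgue measure on the deltoid.

## What is proved

* the four partial derivatives as `HasDerivAt` statements: `hasDerivAt_reTrSU3_left/right`,
  `hasDerivAt_imTr_left/right` (`R₁ = −sin θ₁ − sin(θ₁+θ₂)`, `R₂ = −sin θ₂ − sin(θ₁+θ₂)`,
  `I₁ = cos θ₁ − cos(θ₁+θ₂)`, `I₂ = cos θ₂ − cos(θ₁+θ₂)`);
* `jacobian_eq_im` — `R₁ I₂ − R₂ I₁ = Im(conj(a − c) (b − c))`;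
* **`four_mul_jacobian_sq_eq_weylSU3`** — `4 (R₁ I₂ − R₂ I₁)² = weylSU3 θ₁ θ₂`;
* **`four_mul_jacobian_sq_eq_trace_polynomial`** — `= 27 − 18|t|² + 8 Re t³ − |t|⁴`;
* `jacobian_eq_zero_iff_weylSU3_eq_zero` — the Jacobian vanishes exactly where the Weyl density does.

NOT CLAIMED: any measure-theoretic change of variables / the push-forward density itself; global
injectivity of the trace map on a Weyl alcove; anything for `N ≠ 3`.
-/

namespace Summit.Ventures.LatticeQCDFlow.Scoring

open Complex Real

/-! ## §1 The partial derivatives of `(R, I) = (Re t, Im t)` -/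

/-- `∂R/∂θ₁ = −sin θ₁ − sin(θ₁ + θ₂)`. -/
theorem hasDerivAt_reTrSU3_left (θ₁ θ₂ : ℝ) :
    HasDerivAt (fun x => reTrSU3 x θ₂) (-Real.sin θ₁ - Real.sin (θ₁ + θ₂)) θ₁ := by
  unfold reTrSU3
  have h := ((Real.hasDerivAt_cos θ₁).add (hasDerivAt_const θ₁ (Real.cos θ₂))).add
    (((hasDerivAt_id' θ₁).add_const θ₂).cos)
  exact h.congr_deriv (by ring)

/-- `∂R/∂θ₂ = −sin θ₂ − sin(θ₁ + θ₂)`. -/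
theorem hasDerivAt_reTrSU3_right (θ₁ θ₂ : ℝ) :
    HasDerivAt (fun x => reTrSU3 θ₁ x) (-Real.sin θ₂ - Real.sin (θ₁ + θ₂)) θ₂ := by
  unfold reTrSU3
  have h := ((hasDerivAt_const θ₂ (Real.cos θ₁)).add (Real.hasDerivAt_cos θ₂)).add
    (((hasDerivAt_id' θ₂).const_add θ₁).cos)
  exact h.congr_deriv (by ring)

/-- `∂I/∂θ₁ = cos θ₁ − cos(θ₁ + θ₂)` for `I = sin θ₁ + sin θ₂ − sin(θ₁ + θ₂)`. -/
theorem hasDerivAt_imTr_left (θ₁ θ₂ : ℝ) :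
    HasDerivAt (fun x => Real.sin x + Real.sin θ₂ - Real.sin (x + θ₂))
      (Real.cos θ₁ - Real.cos (θ₁ + θ₂)) θ₁ := by
  have h := ((Real.hasDerivAt_sin θ₁).add (hasDerivAt_const θ₁ (Real.sin θ₂))).sub
    (((hasDerivAt_id' θ₁).add_const θ₂).sin)
  exact h.congr_deriv (by ring)

/-- `∂I/∂θ₂ = cos θ₂ − cos(θ₁ + θ₂)`. -/
theorem hasDerivAt_imTr_right (θ₁ θ₂ : ℝ) :
    HasDerivAt (fun x => Real.sin θ₁ + Real.sin x - Real.sin (θ₁ + x))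
      (Real.cos θ₂ - Real.cos (θ₁ + θ₂)) θ₂ := by
  have h := ((hasDerivAt_const θ₂ (Real.sin θ₁)).add (Real.hasDerivAt_sin θ₂)).sub
    (((hasDerivAt_id' θ₂).const_add θ₁).sin)
  exact h.congr_deriv (by ring)

/-! ## §2 `4 J² = |Δ|²` -/

/-- The Jacobian determinant `R₁ I₂ − R₂ I₁` is `Im( conj(a − c) · (b − c) )` for the eigenvalues
`a = e^{iθ₁}`, `b = e^{iθ₂}`, `c = e^{−i(θ₁+θ₂)}`. -/
theorem jacobian_eq_im (θ₁ θ₂ : ℝ) :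
    (-Real.sin θ₁ - Real.sin (θ₁ + θ₂)) * (Real.cos θ₂ - Real.cos (θ₁ + θ₂))
        - (-Real.sin θ₂ - Real.sin (θ₁ + θ₂)) * (Real.cos θ₁ - Real.cos (θ₁ + θ₂))
      = ((starRingEnd ℂ) (Complex.exp ((θ₁ : ℂ) * Complex.I) -
            Complex.exp (((-(θ₁ + θ₂) : ℝ) : ℂ) * Complex.I)) *
          (Complex.exp ((θ₂ : ℂ) * Complex.I) - Complex.exp (((-(θ₁ + θ₂) : ℝ) : ℂ) * Complex.I))).im := by
  simp only [Complex.mul_im, Complex.sub_re, Complex.sub_im, Complex.conj_re, Complex.conj_im,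
    Complex.exp_ofReal_mul_I_re, Complex.exp_ofReal_mul_I_im, Real.cos_neg, Real.sin_neg]
  ring

/-- **`4 J² = weylSU3`**: four times the squared Jacobian of the torus-to-trace map equals the Weyl
density `|Δ|²`. -/
theorem four_mul_jacobian_sq_eq_weylSU3 (θ₁ θ₂ : ℝ) :
    4 * ((-Real.sin θ₁ - Real.sin (θ₁ + θ₂)) * (Real.cos θ₂ - Real.cos (θ₁ + θ₂))
        - (-Real.sin θ₂ - Real.sin (θ₁ + θ₂)) * (Real.cos θ₁ - Real.cos (θ₁ + θ₂))) ^ 2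
      = weylSU3 θ₁ θ₂ := by
  rw [jacobian_eq_im]
  set a : ℂ := Complex.exp ((θ₁ : ℂ) * Complex.I) with ha
  set b : ℂ := Complex.exp ((θ₂ : ℂ) * Complex.I) with hb
  set c : ℂ := Complex.exp (((-(θ₁ + θ₂) : ℝ) : ℂ) * Complex.I) with hc
  have hna : ‖a‖ = 1 := Complex.norm_exp_ofReal_mul_I θ₁
  have hnb : ‖b‖ = 1 := Complex.norm_exp_ofReal_mul_I θ₂
  have hnc : ‖c‖ = 1 := Complex.norm_exp_ofReal_mul_I (-(θ₁ + θ₂))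
  have habc : a * b * c = 1 := torusTrace_prod_eq_one θ₁ θ₂
  have hca : (starRingEnd ℂ) a = b * c := conj_eq_mul_of_unimodular hna habc
  have hcb : (starRingEnd ℂ) b = a * c := conj_eq_mul_of_unimodular hnb (by rw [← habc]; ring)
  have hcc : (starRingEnd ℂ) c = a * b := conj_eq_mul_of_unimodular hnc (by rw [← habc]; ring)
  set w : ℂ := (starRingEnd ℂ) (a - c) * (b - c) with hw
  -- `w − conj w = (b − a)(c − a)(b − c)` (a ring identity once the conjugates are substituted)
  have hdiff : w - (starRingEnd ℂ) w = (b - a) * (c - a) * (b - c) := by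
    rw [hw]
    simp only [map_mul, Complex.conj_conj, map_sub]
    rw [hca, hcb, hcc]
    ring
  -- `(w − conj w)² = −4 (Im w)²`
  have hsq : (w - (starRingEnd ℂ) w) ^ 2 = -(((4 * w.im ^ 2 : ℝ)) : ℂ) := by
    rw [Complex.sub_conj]
    push_cast
    rw [mul_pow, Complex.I_sq]
    ring
  -- `(a−b)²(a−c)²(b−c)² = disc(t) = −(|a−b||a−c||b−c|)²`
  have hct : (starRingEnd ℂ) (a + b + c) = a * b + a * c + b * c := by
    rw [map_add, map_add, hca, hcb, hcc]; ring
  have hdisc : ((b - a) * (c - a) * (b - c)) ^ 2 =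
      (a + b + c) ^ 2 * ((starRingEnd ℂ) (a + b + c)) ^ 2
        - 4 * ((a + b + c) ^ 3 + ((starRingEnd ℂ) (a + b + c)) ^ 3)
        + 18 * (a + b + c) * (starRingEnd ℂ) (a + b + c) - 27 := by
    rw [hct]
    linear_combination
      (-(4 * (a + b + c) ^ 3 - 18 * (a + b + c) * (a * b + a * c + b * c) + 27 * (a * b * c + 1))) * habc
  have hneg := su3Discriminant_eq_neg_prod_normSq hna hnb hnc habc
  -- assemble: `4 (Im w)² = −Re((w − w̄)²) = (|a−b||a−c||b−c|)² = weylSU3`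
  have hre : (4 * w.im ^ 2 : ℝ) = (‖a - b‖ * ‖a - c‖ * ‖b - c‖) ^ 2 := by
    have h := hsq
    rw [hdiff, hdisc, hneg] at h
    -- `h : −((Π²:ℝ):ℂ) = −((4 (Im w)²:ℝ):ℂ)`
    have h' := Complex.ofReal_injective (neg_injective h)
    linarith
  rw [hre, weylSU3_eq_prod_normSq, ← ha, ← hb, ← hc]
  ring

/-- **`4 J² = 27 − 18|t|² + 8 Re t³ − |t|⁴`** — the squared Jacobian is a polynomial in the trace. -/
theorem four_mul_jacobian_sq_eq_trace_polynomial (θ₁ θ₂ : ℝ) :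
    4 * ((-Real.sin θ₁ - Real.sin (θ₁ + θ₂)) * (Real.cos θ₂ - Real.cos (θ₁ + θ₂))
        - (-Real.sin θ₂ - Real.sin (θ₁ + θ₂)) * (Real.cos θ₁ - Real.cos (θ₁ + θ₂))) ^ 2
      = 27 - 18 * ‖Complex.exp ((θ₁ : ℂ) * Complex.I) + Complex.exp ((θ₂ : ℂ) * Complex.I) +
              Complex.exp (((-(θ₁ + θ₂) : ℝ) : ℂ) * Complex.I)‖ ^ 2
        + 8 * ((Complex.exp ((θ₁ : ℂ) * Complex.I) + Complex.exp ((θ₂ : ℂ) * Complex.I) +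
              Complex.exp (((-(θ₁ + θ₂) : ℝ) : ℂ) * Complex.I)) ^ 3).re
        - ‖Complex.exp ((θ₁ : ℂ) * Complex.I) + Complex.exp ((θ₂ : ℂ) * Complex.I) +
              Complex.exp (((-(θ₁ + θ₂) : ℝ) : ℂ) * Complex.I)‖ ^ 4 := by
  rw [four_mul_jacobian_sq_eq_weylSU3, weylSU3_eq_trace_polynomial]

/-- The Jacobian vanishes exactly where the Weyl density does (the walls: a repeated eigenvalue,
i.e. the boundary of the deltoid). -/
theorem jacobian_eq_zero_iff_weylSU3_eq_zero (θ₁ θ₂ : ℝ) :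
    (-Real.sin θ₁ - Real.sin (θ₁ + θ₂)) * (Real.cos θ₂ - Real.cos (θ₁ + θ₂))
        - (-Real.sin θ₂ - Real.sin (θ₁ + θ₂)) * (Real.cos θ₁ - Real.cos (θ₁ + θ₂)) = 0 ↔
      weylSU3 θ₁ θ₂ = 0 := by
  rw [← four_mul_jacobian_sq_eq_weylSU3]
  constructor
  · intro h; rw [h]; ring
  · intro h
    have : ((-Real.sin θ₁ - Real.sin (θ₁ + θ₂)) * (Real.cos θ₂ - Real.cos (θ₁ + θ₂))
        - (-Real.sin θ₂ - Real.sin (θ₁ + θ₂)) * (Real.cos θ₁ - Real.cos (θ₁ + θ₂))) ^ 2 = 0 := by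
      linarith
    exact pow_eq_zero_iff (n := 2) (by norm_num) |>.mp this

end Summit.Ventures.LatticeQCDFlow.Scoring
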